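import Summits.Ventures.HodgeRepro2.T6PeriodInput6
import Summits.Ventures.HodgeRepro2.T6NAut2Toy
import Summits.Ventures.HodgeRepro2.T6N2ToyIso
import Summits.Ventures.HodgeRepro2.T6N3ToyR
import Summits.Ventures.HodgeRepro2.T6N43BergmanNSide
import Summits.Ventures.HodgeRepro2.T6N42ToyNSide

/-!
# T6PeriodInput6Toy — the M2 v6 theorem COMPOSES on the joint toy (a composition check of the v6 binder set — NOT a §10.5(ii)(d) witness)

SUGGESTION DRAFT by t6-p6 (g8) for the t6-lead's file, 2026-08-25T20:3xZ — the v4 joint toy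
(T6PeriodInput4Toy, p405821) re-cut for v6 (`periodInputN_of_published₆` over the re-cut carrier `NAut3`,
T6PeriodInput6.staged.lean 870c28a4…; T6NAut3 p406934): the carrier is `NAut3.ofNAut2 (toyM F hw hw0)`
(a v2 carrier is a v3 carrier, T6NAut3 `ofNAut2`), the two N4 sides are `N43Toy.bergmanNSide`
(T6N43BergmanNSide p406830: t6-p5's consistent side `N42ToyNSide.toyNSide` with `d43 := N43Toy.bergmanToy.toPlaces`,
`d41` / `d42` / `theta_fin` unchanged), the Bergman-explicit bundles are `XA = XB = N43Toy.bergmanToy`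
(T6N43BergmanToy p406558) with `hx = rfl`, the five N4.3-slot binders are `bergmanNSide_EL₁ / _A2f₂ / _EL₂ /
_A2f₃ / _EL₃`, the three «obvious» bridges `bergmanNSide_conj11_5`, and N2 is consumed display-free
(`hm := magSpec_uOf …`, `he := rfl` — no Shimura 2008 Thm 2.2(i) binder). Everything else is the v4 toy's
argument list, verbatim.

WHAT THIS FILE IS AND IS NOT (t6-lead STATUS l. 11255 (1)): by t6-p1's kernel-checked T6N1Obstruction
(p406480) the four N1 displays assumed below are jointly FALSE on the wiring of `toyNDatumN` (the toy period
is non-zero at the zero Schwartz data), so `toy_periodInputN_of_published₆` is a COMPOSITION CHECK of the v6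
binder set on the toy (every binder but the four N1 displays discharged by the owners' accepted toy lemmas,
the conclusion the true `Hyp.PeriodN (ToyN.toyN F hw0)`), NOT a joint instance; the non-vacuous
§10.5(ii)(d) witness for M2 needs the re-cut carrier AND t6-p1's non-degenerate N1 shadow (the cell's open
Tier-6 item, l. 11258 (b); the joint toy v2, T6PeriodInput6Toy2). Filed by t6-p6 (g9) as the lead's file on
the t6-lead's word (STATUS l. 11316 (5)); it takes p405821's role for v6 (p405821 stays as the v4
composition check).

§8(d): uses an L-value-free non-vanishing device: NO.
-/

namespace Summit.Ventures.HodgeRepro2.T6.PeriodInput6Toy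

open scoped InnerProductSpace
open NAutToyN N2ToyIso N3Toy N42Toy N42ToyNSide N43Toy N5Toy

variable {K : Type} [Field K] [NumberField K] [NumberField.IsCMField K]

/-! ## 1. The carrier -/

/-- The v1 toy carrier with t6-p5's consistent N4 side on both sides: `NAutToyN.toy` with
`sA := sB := N43Toy.bergmanNSide` (T6N43BergmanNSide). -/
noncomputable def toyN (F : FaceSetting K) {σ : K →+* ℂ} {w : KC K} (hw : w ∈ eigenLineK K σ)
    (hw0 : w ≠ 0) : NAut F (toyNDatumN F hw hw0) where
  d3 := N3Toy.toy
  data c := c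
  data_surj φa φb φc φd := ⟨(φa, φb, φc, φd), trivial, rfl⟩
  d1 := toyN1N F hw hw0
  sA := N43Toy.bergmanNSide
  sB := N43Toy.bergmanNSide
  ι5 := Unit
  G5 := Multiplicative ℤ
  d5 := N5Toy.toyData
  hypII_A_of_N5 _ := N3Toy.toy_hypII
  hypII_B_of_N5 _ := N3Toy.toy_hypII

/-- The joint toy carrier: `toyN` made a v2 carrier by t6-p5's explicit-isometry N2 datum `toyIsoF` over
the toy N3 datum (t6-p5's `N2ToyJoint.d2` is this datum). -/
noncomputable def toyM (F : FaceSetting K) {σ : K →+* ℂ} {w : KC K} (hw : w ∈ eigenLineK K σ)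
    (hw0 : w ≠ 0) : NAut2 F (toyNDatumN F hw hw0) :=
  NAut2.ofNAut (toyN F hw hw0) (toyIsoF F (toyNDatumN F hw hw0) N3Toy.toy)

section Carrier

variable (F : FaceSetting K) {σ : K →+* ℂ} {w : KC K} (hw : w ∈ eigenLineK K σ) (hw0 : w ≠ 0)

/-- `hex`: every quadruple of Schwartz data is the data of a choice (`data = id` on the toy). -/
theorem toyM_hex : ∀ (φa : (toyM F hw hw0).d3.A.Sa) (φb : (toyM F hw hw0).d3.A.Sb)
    (φc : (toyM F hw hw0).d3.B.Sa) (φd : (toyM F hw hw0).d3.B.Sb),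
    ∃ c, (toyM F hw hw0).data c = (φa, φb, φc, φd) :=
  fun φa φb φc φd => ⟨(φa, φb, φc, φd), rfl⟩

/-! ## 2. N2: the (N0.3)(b) properties of the explicit-isometry datum -/

/-- `hfr`: the toy frame is a CM frame (t6-p5). -/
theorem toyM_fr : T5CubeTypes.IsCMFrame (toyM F hw hw0).d2.τ :=
  isCMFrame_frameOf F.deg6

/-- `h₁₁₁`: the sign element of type `111` is μ-admissible (t6-p5). -/
theorem toyM_e111 :
    IsLiuSignElement K ((toyM F hw hw0).d2.type T5DatumSimilitude.t111) (toyM F hw hw0).d2.e₁₁₁ :=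
  isLiuSignElement_e111Of (isCMFrame_frameOf F.deg6)

/-- `hAdm`: the sentence N2 and N3 share holds on the toy — the admissible sets are `univ`. -/
theorem toyM_admGenerating : (toyM F hw hw0).d2.AdmGenerating :=
  (toyM F hw hw0).d2.admGenerating_of_admSpanning
    ((toyM F hw hw0).d2.admSpanning_of_univ rfl rfl rfl rfl)

end Carrier

/-! ## 3. N4: t6-p5's consistent toy side -/

/-- GQT Thm 11.7(ii) on the toy N3 side and t6-p5's toy doubling-L datum (`σ = ⊤ ≠ ⊥`). -/
theorem toyD41_thm11_7 : Hyp.GQT2014_Thm11_7_ii N3Toy.toy.A N42ToyNSide.toyD41 := fun _ _ => by simp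

/-! ## 4. N5: the two-element family -/

/-- Theorem 5.6's display on the two sides of the toy N5 datum (both the trivial side). -/
theorem toyData_thm5_6 :
    Hyp.BFGYYZ2025_Thm5_6 ({N5Toy.toyData.A, N5Toy.toyData.B} : Set (N5Skeleton.ToricSide Unit (Multiplicative ℤ))) := by
  intro X hX
  simp only [Set.mem_insert_iff, Set.mem_singleton_iff] at hX
  rcases hX with rfl | rfl <;> exact toySide_dichotomy

/-! ## 5. The M2 theorem on the joint toy -/

/-- THE M2 v6 OBJECT COMPOSES ON THE JOINT TOY: with the four N1 displays ASSUMED (jointly false on this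
wiring — see the module docstring; this is a composition check, not a witness), `periodInputN_of_published₆`
applies to the v3 carrier `NAut3.ofNAut2 toyM` with EVERY OTHER BINDER a theorem on the toy; the conclusion
is `Hyp.PeriodN (ToyN.toyN F hw0)`, which holds outright. -/
theorem toy_periodInputN_of_published₆ (F : FaceSetting K) {σ : K →+* ℂ} {w : KC K}
    (hw : w ∈ eigenLineK K σ) (hw0 : w ≠ 0)
    (hN1H : Hyp.Voisin2002_7_3_2 (toyM F hw hw0).d1)
    (hN1L : Hyp.Voisin2002_Lemma5_4_petersson (toyM F hw hw0).d1)
    (hN1A : Hyp.Liu2021_Prop4_13_vertexLiftA (toyM F hw hw0).d1)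
    (hN1B : Hyp.Liu2021_Prop4_13_vertexLiftB (toyM F hw hw0).d1) :
    ∃ c, (toyNDatumN F hw hw0).AdmChoice c ∧ Hyp.PeriodN ((toyNDatumN F hw hw0).shadow c) :=
  periodInputN_of_published₆ (NAut3.ofNAut2 (toyM F hw hw0)) (toyM_hex F hw hw0)
    -- N2
    (toyM_fr F hw hw0) (toyM_e111 F hw hw0) (magSpec_uOf (isCMFrame_frameOf F.deg6)) rfl
    -- N3iso
    (toyM_admGenerating F hw hw0) toyR toyR_partition toyR_thm14_6_4 toyR_thm14_6_5 toyR_hs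
    toy_AutStable toy_RogawskiBridge toy_AutOrthogonal toy_AutSimple toy_ProductsIn20
    toy_ProductEquivariant toy_ProductsIn20 toy_ProductEquivariant toy_SigmaIsAut rfl
    -- N1 (assumed displays)
    hN1H hN1L hN1A hN1B
    -- N3A
    (fun _ : Unit => toyS) (fun _ => toyS_ganTakeda) toy_HoweDualityBridge toy_KliftCont toy_Seam
    toy_Adjoint toy_KliftLevel toy_ThetaTauType toy_CopiesEquivariant toy_CopiesOrthogonal
    toy_CopiesIncl toy_CopiesTauType toy_TauTypeDecomposes toy_LevelPartFinite toy_LevelPartCont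
    toy_KAverage toy_ThetaEquivariant toy_SpanOfFixedVector toy_CrossCopyOrthogonal
    toy_CopyIndependence toy_TensorsSpan
    -- N3B (the toy's side B is its side A)
    (fun _ : Unit => toyS) (fun _ => toyS_ganTakeda) toy_HoweDualityBridge toy_KliftCont toy_Seam
    toy_Adjoint toy_KliftLevel toy_ThetaTauType toy_CopiesEquivariant toy_CopiesOrthogonal
    toy_CopiesIncl toy_CopiesTauType toy_TauTypeDecomposes toy_LevelPartFinite toy_LevelPartCont
    toy_KAverage toy_ThetaEquivariant toy_SpanOfFixedVector toy_CrossCopyOrthogonal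
    toy_CopyIndependence toy_TensorsSpan
    -- N4: the explicit bundles
    bergmanToy bergmanToy rfl rfl
    -- N4, side A: N4.2 (t6-p5's toy instances, as in `toyJ_N4_via_N4_main`)
    ⟨fun _ => ⟨toyPair_irreducible, toyPair_smooth⟩, fun _ => ⟨trivial_irreducible, trivial_smooth⟩⟩
    (fun _ => Nat.zero_lt_succ 1) (fun _ => Nat.le_succ 2) (fun _ => toyTower_firstLift)
    (fun _ => toyTypeII_minguez) (fun _ => toyTower_ganIchino)
    -- side A: N4.3 (t6-p6's toy instances; the Eischen–Liu binders on `toyD41.Lv (Sum.inr j)`)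
    bergmanNSide_EL₁ bergmanNSide_A2f₂ bergmanNSide_EL₂ bergmanNSide_A2f₃ bergmanNSide_EL₃
    -- side A: the three «obvious» bridges, N4.1 (t6-p5's instances on `toyD41`), `hunr`, the Rallis
    -- bridge, the τ′-refinement
    (bergmanNSide_conj11_5 _ 0) (bergmanNSide_conj11_5 _ 1) (bergmanNSide_conj11_5 _ 2)
    toyD41_GQT toyD41_LR toyD41_padic toyD41_eulerE₁ toyD41_eulerE₂ toyD41_thm31₁ toyD41_thm31₂
    toyD41_prop44₁ toyD41_prop44₂ toyD41_hunr toyD41_thm11_7 (fun _ => toy_hypI)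
    -- N4, side B: the same
    ⟨fun _ => ⟨toyPair_irreducible, toyPair_smooth⟩, fun _ => ⟨trivial_irreducible, trivial_smooth⟩⟩
    (fun _ => Nat.zero_lt_succ 1) (fun _ => Nat.le_succ 2) (fun _ => toyTower_firstLift)
    (fun _ => toyTypeII_minguez) (fun _ => toyTower_ganIchino)
    bergmanNSide_EL₁ bergmanNSide_A2f₂ bergmanNSide_EL₂ bergmanNSide_A2f₃ bergmanNSide_EL₃
    (bergmanNSide_conj11_5 _ 0) (bergmanNSide_conj11_5 _ 1) (bergmanNSide_conj11_5 _ 2)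
    toyD41_GQT toyD41_LR toyD41_padic toyD41_eulerE₁ toyD41_eulerE₂ toyD41_thm31₁ toyD41_thm31₂
    toyD41_prop44₁ toyD41_prop44₂ toyD41_hunr toyD41_thm11_7 (fun _ => toy_hypI)
    -- N5
    toyData_thm5_6 ⟨toySide_levelReduction, toySide_levelReduction⟩ ⟨toySide_condA, toySide_condA⟩
    ⟨toySide_condB, toySide_condB⟩ ⟨toySide_condC, toySide_condC⟩

omit [NumberField.IsCMField K] in
/-- The conclusion on the toy is not vacuous: the shadow of every choice is `ToyN.toyN F hw0`, whose
period input holds outright. -/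
theorem toy_conclusion_holds (F : FaceSetting K) {σ : K →+* ℂ} {w : KC K}
    (hw : w ∈ eigenLineK K σ) (hw0 : w ≠ 0) (c : (toyNDatumN F hw hw0).Choice) :
    Hyp.PeriodN ((toyNDatumN F hw hw0).shadow c) :=
  ToyN.periodN_toyN F hw0 hw

end Summit.Ventures.HodgeRepro2.T6.PeriodInput6Toy
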